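import Literature.Topology.FourManifolds.WhitneySphereEmbeddingProofs
import Literature.Topology.FourManifolds.WhitneyEmbeddingDimension
import HarnessLib

/-!
# Kervaire–Milnor §4, first paragraph, proved: s-parallelizable closed manifolds embed in
# every sphere of codimension `k > n + 1` with a normal framing

Topic `Literature/Topology/FourManifolds` (fact seat
`provefact-Literature.Topology.FourManifolds.exists-b806fed4e8`); proof file attached to
`PontryaginThomCollapse.lean`. It **discharges** the named fact
`Literature.Topology.FourManifolds.exists_isSmoothEmbedding_isNormalFraming_of_isStablyParallelizable`
— Kervaire–Milnor, *Groups of homotopy spheres I* (1963), p. 510, first paragraph of the proof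
of Thm. 4.1: "Given an s-parallelizable closed manifold `M` of dimension `n`, choose an imbedding
`i : M → Sⁿ⁺ᵏ` with `k > n + 1`. Such an imbedding exists and is unique up to differentiable
isotopy. By Lemma 3.3 the normal bundle of `M` is trivial. Now choose a specific field `φ` of
normal `k`-frames" — in the tree's form: for every compact Hausdorff second-countable `C^∞`
manifold `M` modelled on `ℝⁿ` with a continuous framing of `TM ⊕ ℝ`
(`IsStablyParallelizable`) and *every* `k > n + 1`, a `C^∞` embedding `f : M → 𝕊ⁿ⁺ᵏ`
(`Manifold.IsSmoothEmbedding`) with a normal framing by `k` fields (`IsNormalFraming`).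

The two printed ingredients are in the tree, both proved:

* **Whitney** in every dimension `N ≥ 2n + 1` (`WhitneyEmbeddingDimension.lean`,
  `exists_injective_immersion_sphere_of_le`: an injective `C^∞` immersion `M → 𝕊ⁿ⁺ᵏ` for every
  `k ≥ n + 1`, by projection of Mathlib's Whitney embedding along directions off the secants and
  tangents and the inverse stereographic projection);
* **Lemma 3.3** (`WhitneySphereEmbeddingProofs.lean`,
  `exists_isNormalFraming_of_isStablyParallelizable_holds`: the normal bundle of an
  s-parallelizable compact `n`-manifold immersed in `𝕊ⁿ⁺ᵏ`, `n < k`, is framed, via Lemma 3.5);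

and an injective immersion of a compact manifold with a normal framing is a
`Manifold.IsSmoothEmbedding` — the zero section of its tubular neighbourhood
(`IsNormalFraming.isSmoothEmbedding_of_injective`, `FramedTubularNbhd.lean`; Hirsch,
*Differential Topology* (1976), Ch. 1 §3, Thm. 3.1), the empty manifold being treated apart, as in
`exists_isSmoothEmbedding_isNormalFraming_of_isStablyParallelizable_of`
(`WhitneySphereEmbedding.lean`, the `∃ k` form).

## References

* M. Kervaire, J. Milnor, *Groups of homotopy spheres I*, Ann. of Math. 77 (1963), §4, p. 510
  (proof of Thm. 4.1, first paragraph), with §3, Lemma 3.3 (p. 509). [KervaireMilnorAnnals1963]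
* M. W. Hirsch, *Differential Topology*, GTM 33 (1976), Ch. 1 §3, Thms. 3.1 and 3.5.
  [HirschDT1976]
-/

open scoped Manifold ContDiff
open Function Module

noncomputable section

namespace Literature.Topology.FourManifolds

/-- **Kervaire–Milnor p. 510, first paragraph — discharge of the named fact
`exists_isSmoothEmbedding_isNormalFraming_of_isStablyParallelizable`**
(`PontryaginThomCollapse.lean`): an s-parallelizable closed `n`-manifold embeds in `𝕊ⁿ⁺ᵏ` for
*every* `k > n + 1` (Whitney in dimension `n + k ≥ 2n + 1`,
`exists_injective_immersion_sphere_of_le`) with a normal framing by `k` fields (Lemma 3.3,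
`exists_isNormalFraming_of_isStablyParallelizable_holds`, as `n < k`); the injective immersion is
a `Manifold.IsSmoothEmbedding` as the zero section of its tubular neighbourhood
(`IsNormalFraming.isSmoothEmbedding_of_injective`), the empty manifold apart.
[cite: KervaireMilnorAnnals1963, §4, p. 510 (proof of Thm. 4.1, first paragraph) with Lemma 3.3] -/
theorem exists_isSmoothEmbedding_isNormalFraming_of_isStablyParallelizable_holds :
    exists_isSmoothEmbedding_isNormalFraming_of_isStablyParallelizable := by
  intro n M _ _ _ _ _ _ hM k hk
  haveI := fact_finrank_euclideanSpace_succ (n + k)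
  obtain ⟨f, hf, hinj, hf'⟩ :=
    exists_injective_immersion_sphere_of_le (n := n) (M := M) (k := k) (by omega)
  obtain ⟨fr, hfr⟩ :=
    exists_isNormalFraming_of_isStablyParallelizable_holds n k M hM (by omega) f hf hinj hf'
  refine ⟨f, fr, ?_, hfr⟩
  rcases isEmpty_or_nonempty M with hM0 | hM0
  · exact ⟨⟨EuclideanSpace ℝ (Fin k), inferInstance, inferInstance, fun x => isEmptyElim x⟩,
      Topology.IsEmbedding.of_subsingleton f⟩
  · exact hfr.isSmoothEmbedding_of_injective hf hf' hinj (by rw [finrank_euclideanSpace_fin])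


/-! ### The §4 leaf at `n = 7` over the current frontier of named facts

With (a) discharged above, Kervaire–Milnor's §4 at `n = 7` — the named fact
`HomotopySphere.boundsParallelizable_of_isStablyParallelizable_seven` (`HomotopySpheresBP.lean`: an
s-parallelizable homotopy `7`-sphere bounds a parallelizable manifold) — sits over exactly **two**
named facts of the tree, both printed results of Kervaire–Milnor 1963 vendored in
`PontryaginThomCollapse.lean`: (b) Lemma 4.2, `⇒` (`boundsParallelizable_of_collapseNullHomotopic`)
and (c) `0 ∈ p(Σ)` for homotopy `7`-spheres (`HomotopySphere.exists_collapseNullHomotopic_seven`,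
Lemma 4.5 with the Remarks and table of p. 512, `Π₇ / p(S⁷) = coker J₇ = 0`; pre-reduced to a
twist field in `PontryaginThomCollapseTwist.lean`). Its discharge is therefore
`boundsParallelizable_of_isStablyParallelizable_seven_of_frontier` applied to the `_holds` of (b)
and (c), once they exist; no further decomposition of that fact is needed or intended (review of
the split `boundsParallelizable_seven → (Thm. 3.1, §4 at n = 7)`, 2026-08-15: the cut follows the
printed structure, p. 510 "Given an s-parallelizable closed manifold `M` of dimension `n` …", and
the statement is the `n = 7` column of the table p. 512 / Kosinski X §6 p. 218 "since
`Coker J₇ = 0`, `θ⁷ = bP⁸`"). -/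

namespace HomotopySphere

/-- **Kervaire–Milnor §4 at `n = 7` over the current frontier.** An s-parallelizable homotopy
`7`-sphere bounds a parallelizable manifold
(`HomotopySphere.boundsParallelizable_of_isStablyParallelizable_seven`) GIVEN only (b) Lemma 4.2,
`⇒` (`boundsParallelizable_of_collapseNullHomotopic`: a framed tubular embedding with
null-homotopic Pontryagin–Thom collapse bounds a parallelizable manifold) and (c) `0 ∈ p(Σ)`
(`exists_collapseNullHomotopic_seven`: Lemma 4.5 with `coker J₇ = 0`, table p. 512) — the glue
`boundsParallelizable_of_isStablyParallelizable_seven_of` (`PontryaginThomCollapse.lean`) with its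
input (a), the normally framed embedding `Σ ↪ S⁷⁺⁹` (p. 510, first paragraph: Whitney and
Lemma 3.3), fed by the discharge
`exists_isSmoothEmbedding_isNormalFraming_of_isStablyParallelizable_holds` of this file.
[cite: KervaireMilnorAnnals1963, §4, pp. 510–512 (proof of Thm. 4.1: Lemma 4.2, Lemma 4.5, Remarks and table p. 512, n = 7)] [cite: Kosinski1993, Ch. X §6, (6.6) and p. 218 (Coker J₇ = 0, θ⁷ = bP⁸)] -/
theorem boundsParallelizable_of_isStablyParallelizable_seven_of_frontier
    (hb : boundsParallelizable_of_collapseNullHomotopic)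
    (hc : exists_collapseNullHomotopic_seven) :
    boundsParallelizable_of_isStablyParallelizable_seven :=
  boundsParallelizable_of_isStablyParallelizable_seven_of
    exists_isSmoothEmbedding_isNormalFraming_of_isStablyParallelizable_holds hb hc

/-- The same over the frontier, closing also the layer above: **`Θ₇ = bP₈`**
(`HomotopySphere.boundsParallelizable_seven`: every homotopy `7`-sphere bounds a parallelizable
manifold) GIVEN Thm. 3.1 (`HomotopySphere.isStablyParallelizable`), (b) Lemma 4.2 `⇒` and
(c) `0 ∈ p(Σ)` — through `boundsParallelizable_seven_of` (`HomotopySpheresBP.lean`).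
[cite: KervaireMilnorAnnals1963, Thm. 3.1 (p. 508) and §4, pp. 510–512 (table p. 512, n = 7)] -/
theorem boundsParallelizable_seven_of_frontier (h31 : isStablyParallelizable)
    (hb : boundsParallelizable_of_collapseNullHomotopic)
    (hc : exists_collapseNullHomotopic_seven) : boundsParallelizable_seven :=
  boundsParallelizable_seven_of h31
    (boundsParallelizable_of_isStablyParallelizable_seven_of_frontier hb hc)

end HomotopySphere

end Literature.Topology.FourManifolds
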